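import Summits.QuantumFields.QCD.Theses.HeatSlicedQuarks
import Literature.MathematicalPhysics.QuantumLattice.OverlapLocality

/-!
# Sketch (crux-ideate r1, ideator 3) — first lemmas / transfer statements for the crux
`SmallFieldUltracontractivity` (stmt-QuantumFields-8871), cards

* `gamma5-harmonic-lift`      : `QHarmonicLiftSupBound` (transfer C⁺, first lemma), `FreeLiftKernelDecay`
                                (free 5D Poisson-type kernel, support), `LiftReduction` (the claim C⁺ → crux);
* `ballistic-mirror-erasure`  : `WavePacketLocality` (first lemma, provable now), `SmallLinkUltracontractivity`
                                (transfer C⁺: Kato-drift regime), `MirrorReduction` (the claim C⁺ → crux).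

Both cards use the HERMITIAN Wilson–Dirac operator `Q_U = Γ₅ D_W(U,m,1)` (tree:
`spinorLift gammaFive * wilsonDirac …`, `Q_U² = D_Wᴴ D_W` is the landed
`Summit.QuantumFields.QCD.Theorems.WegnerEstimateNegative.hermitianWilsonDirac_mul_self`).
Statements only (Props); nothing is asserted.
-/

namespace Summit.QuantumFields.QCD.Cruxes.SmallFieldUltracontractivity.R1I3

open Literature.MathematicalPhysics.QuantumLattice Literature.MathematicalPhysics.QuantumFieldTheory
open Literature.Probability.LatticeModels (TorusSite)
open scoped Matrix Kronecker ComplexConjugate Matrix.Norms.L2Operator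

noncomputable section

/-- Colour group. -/
abbrev SU3 : Type := Matrix.specialUnitaryGroup (Fin 3) ℂ

/-- Quark index set on the `L`-torus. -/
abbrev Idx (L : ℕ) : Type := TorusSite 4 L × Fin 3 × Fin 4

/-- The free configuration. -/
abbrev freeCfg (L : ℕ) : GaugeConfig 4 L SU3 := fun _ => 1

/-- The Hermitian Wilson–Dirac operator `Q_U = Γ₅ · D_W(U, m, r = 1)` (`Q_U² = D_Wᴴ D_W = H_U`). -/
abbrev hermQ {L : ℕ} [NeZero L] (U : GaugeConfig 4 L SU3) (m : ℝ) : Matrix (Idx L) (Idx L) ℂ :=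
  spinorLift gammaFive * wilsonDirac (fundamentalRep (Fin 3)) U m 1

/-- Plaquette deficit `3 − Re tr U_p` (the crux's smallness quantity). -/
abbrev deficit {L : ℕ} (U : GaugeConfig 4 L SU3) (y : TorusSite 4 L) (μ ν : Fin 4) : ℝ :=
  3 - ((fundamentalRep (Fin 3)) (plaquetteHolonomy U y μ ν)).trace.re

/-- Heat-kernel entry of the crux. -/
abbrev kernelEntry {L : ℕ} [NeZero L] (U : GaugeConfig 4 L SU3) (m t : ℝ) (x : TorusSite 4 L)
    (a b : Fin 3) (α β : Fin 4) : ℝ :=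
  ‖(NormedSpace.exp (-(t : ℂ) • (Matrix.conjTranspose
      (wilsonDirac (fundamentalRep (Fin 3)) U m 1) * wilsonDirac (fundamentalRep (Fin 3)) U m 1)))
    (x, a, α) (x, b, β)‖

/-! ## Card A — `gamma5-harmonic-lift` -/

/-- **C⁺_A (transfer / first lemma): interior sup bound for `Q`-harmonic lifts.**  If `U` is
`(ε/ρ²)`-flat on the (non-wrapping) cube of radius `2ρ` around `x`, then every quark field `ψ` whose
two-sided `Q_U`-flow stays bounded on the slab `|s| ≤ ρ` — `‖e^{sQ_U}ψ‖² ≤ 9‖ψ‖²`, which is what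
band-limited vectors `ψ ∈ Ran 1_{[0,ρ⁻²]}(H_U)` satisfy with room (`e² < 9`) — obeys the free
power-counting sup bound `|ψ(x)|² ≤ C ρ⁻⁴ ‖ψ‖²` at the centre.  Mechanism: `Φ(s) = e^{sQ_U}ψ` solves the
5D first-order system `(∂_s − Q_U)Φ = 0`; Cauchy–Pompeiu with the free 5D kernel (`FreeLiftKernelDecay`)
and one weighted absorption (perturbation `Q_U − Q_1` is zeroth order, `≤ 3δ·dist` in the comb gauge). -/
def QHarmonicLiftSupBound : Prop :=
  ∃ ε : ℝ, 0 < ε ∧ ∃ C : ℝ, ∀ (L : ℕ) [NeZero L] (U : GaugeConfig 4 L SU3) (m : ℝ),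
    m ∈ Set.Icc (-(1 / 2 : ℝ)) 1 → ∀ (x : TorusSite 4 L) (ρ : ℕ), 1 ≤ ρ → 4 * ρ ≤ L →
    (∀ y : TorusSite 4 L, torusDist x y ≤ 2 * ρ → ∀ μ ν : Fin 4,
        deficit U y μ ν ≤ (ε / (ρ : ℝ) ^ 2) ^ 2) →
    ∀ ψ : Idx L → ℂ,
      (∀ s : ℝ, |s| ≤ ρ →
        ∑ i, ‖(NormedSpace.exp ((s : ℂ) • hermQ U m)).mulVec ψ i‖ ^ 2 ≤ 9 * ∑ i, ‖ψ i‖ ^ 2) →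
      ∀ (a : Fin 3) (α : Fin 4), ‖ψ (x, a, α)‖ ^ 2 ≤ C / (ρ : ℝ) ^ 4 * ∑ i, ‖ψ i‖ ^ 2

/-- **Free 5D lift kernel (support, provable now / M–L).**  The fundamental solution of `∂_s − Q_1` on
torus × ℝ is `G₅(·, s) = ½ (sgn s − sgn Q_1) e^{−|s| |Q_1|}` (functional calculus of the free
Hermitian Wilson–Dirac operator); its entries decay like the 5D Newtonian rate `(1 + d + |s|)⁻⁴`
(plus the torus zero-mode floor `L⁻⁴`), uniformly in `m ∈ [−1/2, 1]`. -/
def FreeLiftKernelDecay : Prop :=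
  ∃ C : ℝ, ∀ (L : ℕ) [NeZero L] (m : ℝ), m ∈ Set.Icc (-(1 / 2 : ℝ)) 1 → ∀ (s : ℝ)
    (x y : TorusSite 4 L) (a b : Fin 3) (α β : Fin 4),
    ‖(cfc (fun l : ℝ => (Real.sign s - Real.sign l) / 2 * Real.exp (-(|s| * |l|)))
        (hermQ (freeCfg L) m)) (x, a, α) (y, b, β)‖ ≤
      C * (1 / (1 + (torusDist x y : ℝ) + |s|) ^ 4 + 1 / (L : ℝ) ^ 4)

/-- The card-A claim (sup principle of `Disproof.lean` §C + scale bookkeeping): C⁺_A implies the crux. -/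
def LiftReduction : Prop :=
  QHarmonicLiftSupBound → Summit.QuantumFields.QCD.Theses.HeatSlicedQuarks.SmallFieldUltracontractivity

/-! ## Card B — `ballistic-mirror-erasure` -/

/-- **First lemma (provable now): ballistic locality of the Dirac wave packet.**  If two
configurations agree on every link based within `torusDist ≤ N` of `x`, the `x`-columns of their wave
groups `e^{iτQ}` agree up to the Taylor tail beyond order `N` (`‖Q_U‖ ≤ 13` for `|m| ≤ 1`; `Qⁿ δ_x`
only sees links within distance `n`): a light cone with SUPER-exponentially small leakage. -/
def WavePacketLocality : Prop :=
  ∀ (L : ℕ) [NeZero L] (U V : GaugeConfig 4 L SU3) (m : ℝ), m ∈ Set.Icc (-(1 / 2 : ℝ)) 1 →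
    ∀ (x : TorusSite 4 L) (N : ℕ) (τ : ℝ),
    (∀ (y : TorusSite 4 L) (μ : Fin 4), torusDist x y ≤ N → U (y, μ) = V (y, μ)) →
    ∀ (a : Fin 3) (α : Fin 4),
      ∑ i, ‖(NormedSpace.exp (((τ : ℂ) * Complex.I) • hermQ U m) -
              NormedSpace.exp (((τ : ℂ) * Complex.I) • hermQ V m)) i (x, a, α)‖ ^ 2 ≤
        (2 * ((13 * |τ|) ^ (N + 1) / ((N + 1).factorial : ℝ)) * Real.exp (13 * |τ|)) ^ 2

/-- **C⁺_B (transfer target): ultracontractivity in the Kato-drift regime.**  For ANY configuration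
whose links are all within `η` of the identity (no plaquette hypothesis), the on-diagonal kernel has
free power counting `C/t²` as long as `η² t ≤ c₀` (and `1 ≤ t ≤ L²`): `H = (Q_1 + Γ₅E)²` with a
bounded zeroth-order `E` is a first-order (drift-type) perturbation of `Q_1²`, and the Dyson series
in Gaussian kernel norms converges with the derivative always on the free factor.  The crux reduces
to this after mirror erasure (`MirrorReduction`), with `η ≍ ε/ρ`, `t ≤ ρ²`. -/
def SmallLinkUltracontractivity : Prop :=
  ∃ c₀ : ℝ, 0 < c₀ ∧ ∃ C : ℝ, ∀ (L : ℕ) [NeZero L] (U : GaugeConfig 4 L SU3) (m : ℝ),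
    m ∈ Set.Icc (-(1 / 2 : ℝ)) 1 → ∀ (η : ℝ),
    (∀ (y : TorusSite 4 L) (μ : Fin 4),
        ‖(fundamentalRep (Fin 3)) (U (y, μ)) - (1 : Matrix (Fin 3) (Fin 3) ℂ)‖ ≤ η) →
    ∀ (t : ℝ), 1 ≤ t → t ≤ (L : ℝ) ^ 2 → η ^ 2 * t ≤ c₀ →
    ∀ (x : TorusSite 4 L) (a b : Fin 3) (α β : Fin 4), kernelEntry U m t x a b α β ≤ C / t ^ 2

/-- The card-B claim: sup principle + smoothed-window bootstrap + `WavePacketLocality` + reflection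
(mirror) extension + global comb gauge on the mirror torus reduce the crux to C⁺_B. -/
def MirrorReduction : Prop :=
  SmallLinkUltracontractivity →
    Summit.QuantumFields.QCD.Theses.HeatSlicedQuarks.SmallFieldUltracontractivity

/-! ## Sanity: the free configuration satisfies the hypotheses of both transfer targets. -/

example (L : ℕ) (y : TorusSite 4 L) (μ ν : Fin 4) : deficit (freeCfg L) y μ ν = 0 := by
  simp [deficit, plaquetteHolonomy, Matrix.trace_one]

end

end Summit.QuantumFields.QCD.Cruxes.SmallFieldUltracontractivity.R1I3
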